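/-
Copyright (c) 2026. All rights reserved.
Released under Apache 2.0 license as described in the file LICENSE.
-/
import Mathlib
import HarnessLib
import Literature.MathematicalPhysics.QuantumLattice.GaugeGroups
import Literature.MathematicalPhysics.QuantumFieldTheory.ConstructiveQFTWave0
import Literature.MathematicalPhysics.QuantumFieldTheory.LatticeGaugeProofs
import Literature.MathematicalPhysics.QuantumFieldTheory.U1GinibreComparison
import Literature.MathematicalPhysics.QuantumLattice.AbelianFieldTensor
import Literature.MathematicalPhysics.QuantumLattice.AbelianMagneticFlux
import Summits.Ventures.LatticeQCDFlow.Exactness.SymmetricMetropolis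
import Summits.Ventures.LatticeQCDFlow.Exactness.CompactHaar
import Summits.Ventures.LatticeQCDFlow.Scaling.LatticePeeling
import Summits.Ventures.LatticeQCDFlow.Scaling.SliceTwistWitness
import Summits.Ventures.LatticeQCDFlow.Scaling.FluxTunnellingU1Explicit
import Summits.Ventures.LatticeQCDFlow.Scaling.BoxSpreadWitness
import Summits.Ventures.LatticeQCDFlow.Scaling.BoxTouch
import Summits.Ventures.LatticeQCDFlow.Scaling.FluxTunnellingU1MaxPlaquette
import Summits.Ventures.LatticeQCDFlow.Scaling.FluxInsertionKernel
import Summits.Ventures.LatticeQCDFlow.Scaling.FluxInsertionBox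
import Summits.Ventures.LatticeQCDFlow.Scaling.ConvolutionPowerCompensation
import Summits.Ventures.LatticeQCDFlow.Scaling.FluxInsertionSharpFloor
import Summits.Ventures.LatticeQCDFlow.Scaling.FluxInsertionSharpFloorInstances
import Summits.Ventures.LatticeQCDFlow.Scaling.FluxInsertionSharpRate
import Literature.MathematicalPhysics.QuantumFieldTheory.TorusFreeTransfer

/-!
# The exact min–max identity for insertion kernels (item 106a)

HONEST FRAMING: exact (Metropolis-corrected) sampling algorithms for lattice gauge theory;
figures of merit are autocorrelation/cost numbers at stated couplings and volumes; no
continuum-physics claim.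

Venture `LatticeQCDFlow` (cell pub-lqcd), topic `Scaling`, FANOUT row 29 (theory2, gen-20), item 106a
(imports item 105).  NEW WORK; nothing here is cited as a fact.

For gen-19's two-sided insertion Metropolis kernel `K_W` (propose `WU` or `W⁻¹U` with probability
`½`, accept with `min{1, e^{−β(S(proposal) − S(U))}}`) and ANY real-valued (here: integer-valued) measurable charge `Q`, the equilibrium
probability of a charge change is an explicit Laplace-type integral — no invariance, no locality, no
estimate:

  `(μ_β ⊗ K_W){Q ≠ Q'} = Z_β⁻¹ · ½ · Σ_{X ∈ {W, W⁻¹}} ∫_{Q(XU) ≠ Q(U)} e^{−β max(S(U), S(XU))} dHaar(U)`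

(`wilson_compProd_insertionMH_topCharge_ne_eq`, from `e^{−βS(U)} min{1, e^{−β(S(XU)−S(U))}} =
e^{−β max(S(U),S(XU))}`, `exp_mul_min_eq_exp_max`).  Consequently the `β → ∞` rate of
`(μ_β ⊗ K_W){Q ≠ Q'}` at FIXED volume is governed by the ESSENTIAL INFIMUM of
`max(S(U), S(XU))` over the charge-changing configurations (the "min–max height"; item 106b):
the generic Laplace bounds `setLIntegral_exp_le_of_le_essHeight`, `setLIntegral_exp_ge_essHeight`,
`measure_lt_essHeight_add_pos`, and the partition-function bounds
`e^{−βε} · Haar{S ≤ ε} ≤ Z_β ≤ 1` with `0 < Haar{S ≤ ε}` (`partitionFunction_u1_le_one`,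
`partitionFunction_u1_ge`, `u1Haar_action_le_pos`).  One reducible `def` (`u1Haar`) and one `def`
(`essHeight`); `Z_β ≤ 1` is gen-8's `Lattice.partitionFunction_le_one`.
-/

noncomputable section

open MeasureTheory ProbabilityTheory Filter Topology Real
open scoped ENNReal
open Literature.MathematicalPhysics.QuantumFieldTheory Literature.MathematicalPhysics.QuantumLattice
open Summit.Ventures.LatticeQCDFlow.Exactness

namespace Summit.Ventures.LatticeQCDFlow.Theory2.Lattice.Flux

/-! ## §1 The pointwise identity and the kernel mass of the charge-change event -/

section Generic

variable {G : Type*} [Group G] [MeasurableSpace G] [MeasurableMul₂ G]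

omit [Group G] [MeasurableSpace G] [MeasurableMul₂ G] in
/-- `e^{−βa} · min{1, e^{−β(b−a)}} = e^{−β max(a,b)}` (`β ≥ 0`). [folklore] -/
theorem exp_mul_min_eq_exp_max {β a b : ℝ} (hβ : 0 ≤ β) :
    Real.exp (-β * a) * min 1 (Real.exp (-(β * (b - a)))) = Real.exp (-(β * max a b)) := by
  rcases le_total a b with h | h
  · have h1 : Real.exp (-(β * (b - a))) ≤ 1 := by
      rw [Real.exp_le_one_iff, neg_nonpos]; exact mul_nonneg hβ (sub_nonneg.mpr h)
    rw [max_eq_right h, min_eq_right h1, ← Real.exp_add]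
    congr 1; ring
  · have h1 : 1 ≤ Real.exp (-(β * (b - a))) := by
      rw [Real.one_le_exp_iff]; nlinarith [mul_nonneg hβ (sub_nonneg.mpr h)]
    rw [max_eq_left h, min_eq_left h1, mul_one]
    congr 1; ring

/-- The kernel mass of the charge-change event at `U`:
`K_W(U, {Q ≠ Q(U)}) = ½(1_{Q(WU) ≠ Q(U)} a(U, WU) + 1_{Q(W⁻¹U) ≠ Q(U)} a(U, W⁻¹U))`
(the rejection branch never changes the charge). [folklore] -/
theorem insertionMH_chargeNe_apply {Q : G → ℝ} (hQ : Measurable Q) (W : G) {p : G → ℝ}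
    (hp : Measurable p) (U : G) :
    insertionMH W p U {V | Q U ≠ Q V} =
      2⁻¹ * ({U | Q (W * U) ≠ Q U}.indicator (fun U => imhAcceptE p U (W * U)) U +
        {U | Q (W⁻¹ * U) ≠ Q U}.indicator (fun U => imhAcceptE p U (W⁻¹ * U)) U) := by
  have hB : MeasurableSet {V | Q U ≠ Q V} := (measurableSet_eq_fun measurable_const hQ).compl
  rw [insertionMH_apply W hp U hB,
    Set.indicator_of_notMem (show U ∉ {V | Q U ≠ Q V} from fun h => h rfl), mul_zero, add_zero]
  have key : ∀ X : G, {V | Q U ≠ Q V}.indicator (imhAcceptE p U) (X * U) =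
      {U | Q (X * U) ≠ Q U}.indicator (fun U => imhAcceptE p U (X * U)) U := by
    intro X
    by_cases h : Q (X * U) = Q U
    · rw [Set.indicator_of_notMem (show X * U ∉ {V | Q U ≠ Q V} from fun hm => hm h.symm),
        Set.indicator_of_notMem (show U ∉ {U | Q (X * U) ≠ Q U} from fun hm => hm h)]
    · rw [Set.indicator_of_mem (show X * U ∈ {V | Q U ≠ Q V} from fun e => h e.symm),
        Set.indicator_of_mem (show U ∈ {U | Q (X * U) ≠ Q U} from h)]
  rw [key W, key W⁻¹]

/-- Measurability of `U ↦ a(U, XU)`. [folklore] -/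
theorem measurable_imhAcceptE_mul {p : G → ℝ} (hp : Measurable p) (X : G) :
    Measurable fun U => imhAcceptE p U (X * U) :=
  (measurable_imhAcceptE hp).comp (measurable_id.prodMk (measurable_const_mul X))

/-- Measurability of the charge-change set of the insertion `X`. [folklore] -/
theorem measurableSet_chargeNe_mul {Q : G → ℝ} (hQ : Measurable Q) (X : G) :
    MeasurableSet {U | Q (X * U) ≠ Q U} :=
  (measurableSet_eq_fun (hQ.comp (measurable_const_mul X)) hQ).compl

/-- **The event as an integral** (any s-finite `μ`):
`(μ ⊗ K_W){Q ≠ Q'} = ∫ ½(1_{A_W} a(U,WU) + 1_{A_{W⁻¹}} a(U,W⁻¹U)) dμ`. [folklore] -/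
theorem compProd_insertionMH_chargeNe {Q : G → ℝ} (hQ : Measurable Q) (W : G) {p : G → ℝ}
    (hp : Measurable p) (μ : Measure G) [SFinite μ] :
    (μ ⊗ₘ insertionMH W p) {q | Q q.1 ≠ Q q.2} =
      ∫⁻ U, 2⁻¹ * ({U | Q (W * U) ≠ Q U}.indicator (fun U => imhAcceptE p U (W * U)) U +
        {U | Q (W⁻¹ * U) ≠ Q U}.indicator (fun U => imhAcceptE p U (W⁻¹ * U)) U) ∂μ := by
  haveI : Fact (Measurable p) := ⟨hp⟩
  have hE : MeasurableSet {q : G × G | Q q.1 ≠ Q q.2} :=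
    (measurableSet_eq_fun (hQ.comp measurable_fst) (hQ.comp measurable_snd)).compl
  rw [Measure.compProd_apply hE]
  refine lintegral_congr fun U => ?_
  exact insertionMH_chargeNe_apply hQ W hp U

end Generic

/-! ## §2 Generic Laplace bounds through the essential infimum -/

section Laplace

variable {α : Type*} [MeasurableSpace α]

/-- The **essential height** of `f ≥ 0` on `A` under `ν`: `ess inf_{ν|A} f`, as an extended
non-negative real (`⊤` iff `ν(A) = 0`). [folklore] -/
def essHeight (ν : Measure α) (A : Set α) (f : α → ℝ) : ℝ≥0∞ :=
  essInf (fun U => ENNReal.ofReal (f U)) (ν.restrict A)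

variable (ν : Measure α) (A : Set α) (f : α → ℝ)

/-- `ν|A`-a.e., `essHeight ≤ f`. [folklore] -/
theorem ae_essHeight_le : ∀ᵐ U ∂(ν.restrict A), essHeight ν A f ≤ ENNReal.ofReal (f U) :=
  ae_essInf_le

/-- An infinite height means `ν(A) = 0`. [folklore] -/
theorem restrict_eq_zero_of_essHeight_eq_top (h : essHeight ν A f = ⊤) : ν.restrict A = 0 := by
  have hae := ae_essHeight_le ν A f
  rw [h] at hae
  have : ∀ᵐ U ∂(ν.restrict A), False :=
    hae.mono fun U hU => ENNReal.ofReal_ne_top (top_le_iff.mp hU)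
  exact ae_eq_bot.mp (Filter.eventually_false_iff_eq_bot.mp this)

/-- **Laplace upper bound**: `∫_A e^{−βf} dν ≤ e^{−βE} ν(A)` for every finite `E ≤ essHeight`
(`β ≥ 0`, `f ≥ 0`). [folklore] -/
theorem setLIntegral_exp_le_of_le_essHeight {β : ℝ} (hβ : 0 ≤ β) (hf : ∀ U, 0 ≤ f U) {E : ℝ≥0∞}
    (hE : E ≤ essHeight ν A f) (hEt : E ≠ ⊤) :
    ∫⁻ U in A, ENNReal.ofReal (Real.exp (-(β * f U))) ∂ν ≤
      ENNReal.ofReal (Real.exp (-(β * E.toReal))) * ν A := by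
  have hae : ∀ᵐ U ∂(ν.restrict A), E ≤ ENNReal.ofReal (f U) :=
    (ae_essHeight_le ν A f).mono fun U hU => hE.trans hU
  have _ := hEt
  calc ∫⁻ U in A, ENNReal.ofReal (Real.exp (-(β * f U))) ∂ν
      ≤ ∫⁻ _ in A, ENNReal.ofReal (Real.exp (-(β * E.toReal))) ∂ν :=
        lintegral_mono_ae (hae.mono fun U hU => ENNReal.ofReal_le_ofReal (Real.exp_le_exp.mpr
          (neg_le_neg (mul_le_mul_of_nonneg_left (ENNReal.toReal_le_of_le_ofReal (hf U) hU) hβ))))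
    _ = ENNReal.ofReal (Real.exp (-(β * E.toReal))) * ν A := setLIntegral_const _ _

/-- **The near-minimal set has positive measure**: `0 < ν(A ∩ {f < essHeight + ε})` whenever the
height is finite (`ε > 0`). [folklore] -/
theorem measure_lt_essHeight_add_pos {ε : ℝ} (hε : 0 < ε) (hH : essHeight ν A f ≠ ⊤) :
    0 < (ν.restrict A) {U | f U < (essHeight ν A f).toReal + ε} := by
  rw [pos_iff_ne_zero]
  intro h0
  have hae : ∀ᵐ U ∂(ν.restrict A),
      ENNReal.ofReal ((essHeight ν A f).toReal + ε) ≤ ENNReal.ofReal (f U) := by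
    have h0' : ∀ᵐ U ∂(ν.restrict A), ¬ (f U < (essHeight ν A f).toReal + ε) :=
      ae_iff.mpr (by simpa only [not_not] using h0)
    exact h0'.mono fun U hU => ENNReal.ofReal_le_ofReal (not_lt.mp hU)
  have h1 : ENNReal.ofReal ((essHeight ν A f).toReal + ε) ≤ essHeight ν A f :=
    le_essInf_of_ae_le _ hae
  have h2 := ENNReal.toReal_mono hH h1
  rw [ENNReal.toReal_ofReal (by positivity)] at h2
  linarith

/-- **Laplace lower bound**: `e^{−β(H + ε)} ν(A ∩ {f < H + ε}) ≤ ∫_A e^{−βf} dν` with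
`H = essHeight` (`β ≥ 0`, `f` measurable). [folklore] -/
theorem setLIntegral_exp_ge_essHeight {β : ℝ} (hβ : 0 ≤ β) (hfm : Measurable f) (ε : ℝ) :
    ENNReal.ofReal (Real.exp (-(β * ((essHeight ν A f).toReal + ε)))) *
        (ν.restrict A) {U | f U < (essHeight ν A f).toReal + ε} ≤
      ∫⁻ U in A, ENNReal.ofReal (Real.exp (-(β * f U))) ∂ν := by
  set c := (essHeight ν A f).toReal + ε
  have hB : MeasurableSet {U | f U < c} := measurableSet_lt hfm measurable_const
  calc ENNReal.ofReal (Real.exp (-(β * c))) * (ν.restrict A) {U | f U < c}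
      = ∫⁻ _ in {U | f U < c}, ENNReal.ofReal (Real.exp (-(β * c))) ∂(ν.restrict A) :=
        (setLIntegral_const _ _).symm
    _ ≤ ∫⁻ U in {U | f U < c}, ENNReal.ofReal (Real.exp (-(β * f U))) ∂(ν.restrict A) :=
        setLIntegral_mono (by fun_prop) fun U hU => ENNReal.ofReal_le_ofReal
          (Real.exp_le_exp.mpr (neg_le_neg (mul_le_mul_of_nonneg_left (le_of_lt hU) hβ)))
    _ ≤ ∫⁻ U, ENNReal.ofReal (Real.exp (-(β * f U))) ∂(ν.restrict A) :=
        setLIntegral_le_lintegral _ _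

end Laplace

/-! ## §3 The `U(1)` reference measure and the partition function -/

section Wilson

variable {d L : ℕ} [NeZero L]

variable (d L) in
/-- The product Haar probability measure on `U(1)` configurations of the torus. [folklore] -/
abbrev u1Haar : Measure (GaugeConfig d L Circle) := Measure.pi fun _ : Edge d L => haarProbability Circle

/-- The density `e^{−βS}` is measurable. [folklore] -/
theorem measurable_u1Density (β : ℝ) :
    Measurable fun U : GaugeConfig d L Circle =>
      ENNReal.ofReal (Real.exp (-β * wilsonAction u1Rep U)) :=
  (measurable_u1Weight β).ennreal_ofReal

/-- `Z_β = ∫ e^{−βS} dHaar`. [folklore] -/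
theorem partitionFunction_u1_eq (β : ℝ) :
    partitionFunction (d := d) (L := L) u1Rep β =
      ∫⁻ U, ENNReal.ofReal (Real.exp (-β * wilsonAction u1Rep U)) ∂(u1Haar d L) := by
  rw [partitionFunction, wilsonWeight, withDensity_apply _ MeasurableSet.univ, Measure.restrict_univ]

/-- `Z_β ≤ 1` (`β ≥ 0`; gen-8's `Lattice.partitionFunction_le_one` with `Re tr ≤ 1`). [folklore] -/
theorem partitionFunction_u1_le_one {β : ℝ} (hβ : 0 ≤ β) :
    partitionFunction (d := d) (L := L) u1Rep β ≤ 1 :=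
  Lattice.partitionFunction_le_one (ρ := u1Rep) U1.re_trace_u1Rep_le hβ

/-- `e^{−βε} · Haar{S ≤ ε} ≤ Z_β` (`β ≥ 0`). [folklore] -/
theorem partitionFunction_u1_ge {β : ℝ} (hβ : 0 ≤ β) (ε : ℝ) :
    ENNReal.ofReal (Real.exp (-(β * ε))) * (u1Haar d L) {U | wilsonAction u1Rep U ≤ ε} ≤
      partitionFunction (d := d) (L := L) u1Rep β := by
  have hB : MeasurableSet {U : GaugeConfig d L Circle | wilsonAction u1Rep U ≤ ε} :=
    measurableSet_le (measurable_wilsonAction (d := d) (L := L) u1Rep continuous_u1Rep) measurable_const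
  rw [partitionFunction_u1_eq, ← setLIntegral_const]
  calc ∫⁻ _ in {U | wilsonAction u1Rep U ≤ ε}, ENNReal.ofReal (Real.exp (-(β * ε))) ∂(u1Haar d L)
      ≤ ∫⁻ U in {U | wilsonAction u1Rep U ≤ ε},
          ENNReal.ofReal (Real.exp (-β * wilsonAction u1Rep U)) ∂(u1Haar d L) :=
        setLIntegral_mono (measurable_u1Density β) fun U hU => ENNReal.ofReal_le_ofReal
          (Real.exp_le_exp.mpr (by rw [neg_mul]; exact neg_le_neg (mul_le_mul_of_nonneg_left hU hβ)))
    _ ≤ _ := setLIntegral_le_lintegral _ _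

/-- `0 < Haar{S ≤ ε}` for `ε > 0`: the action is continuous and vanishes at `U = 1`, and the
product Haar measure charges open sets. [folklore] -/
theorem u1Haar_action_le_pos {ε : ℝ} (hε : 0 < ε) :
    0 < (u1Haar d L) {U | wilsonAction u1Rep U ≤ ε} := by
  have ho : IsOpen {U : GaugeConfig d L Circle | wilsonAction u1Rep U < ε} :=
    isOpen_lt (continuous_wilsonAction u1Rep continuous_u1Rep) continuous_const
  have h1 : wilsonAction u1Rep (1 : GaugeConfig d L Circle) = 0 := by
    rw [wilsonAction_u1_eq]; simp [plaquetteHolonomy]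
  have hne : (1 : GaugeConfig d L Circle) ∈
      {U : GaugeConfig d L Circle | wilsonAction u1Rep U < ε} := by
    simp only [Set.mem_setOf_eq, h1]; exact hε
  exact (ho.measure_pos (u1Haar d L) ⟨1, hne⟩).trans_le
    (measure_mono fun U hU => show wilsonAction u1Rep U ≤ ε from le_of_lt hU)

/-! ## §4 The exact identity for the Wilson measure -/

/-- `e^{−βS(U)} · a(U, XU) = e^{−β max(S(U), S(XU))}`. [folklore] -/
theorem u1Density_mul_imhAcceptE {β : ℝ} (hβ : 0 ≤ β) (X U : GaugeConfig d L Circle) :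
    ENNReal.ofReal (Real.exp (-β * wilsonAction u1Rep U)) * imhAcceptE (u1Weight β) U (X * U) =
      ENNReal.ofReal (Real.exp (-(β * max (wilsonAction u1Rep U) (wilsonAction u1Rep (X * U))))) := by
  rw [show imhAcceptE (u1Weight β) U (X * U) =
      imhAcceptE (fun U => Real.exp (-β * wilsonAction u1Rep U)) U (X * U) from rfl,
    imhAcceptE_exp, ← ENNReal.ofReal_mul (Real.exp_nonneg _), exp_mul_min_eq_exp_max hβ]

/-- The Laplace integrand of the insertion `X`. [folklore] -/
theorem measurable_expMax (β : ℝ) (X : GaugeConfig d L Circle) :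
    Measurable fun U : GaugeConfig d L Circle =>
      ENNReal.ofReal (Real.exp (-(β * max (wilsonAction u1Rep U) (wilsonAction u1Rep (X * U))))) := by
  have h := measurable_wilsonAction (d := d) (L := L) u1Rep continuous_u1Rep
  exact ((measurable_const.mul (h.max (h.comp (measurable_const_mul X)))).neg.exp).ennreal_ofReal

/-- **The exact min–max identity.**  For every `W`, `β ≥ 0` and base plaquette data,
`(μ_β ⊗ K_W){Q ≠ Q'} = Z_β⁻¹ · ½ · Σ_{X ∈ {W,W⁻¹}} ∫_{Q(XU) ≠ Q(U)} e^{−β max(S(U),S(XU))} dHaar`.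
[folklore] -/
theorem wilson_compProd_insertionMH_topCharge_ne_eq {β : ℝ} (hβ : 0 ≤ β)
    (W : GaugeConfig d L Circle) (x₀ : Site d L) (μ' ν' : Fin d) :
    ((wilsonMeasure u1Rep β) ⊗ₘ insertionMH W (u1Weight β))
        {q | topCharge x₀ μ' ν' q.1 ≠ topCharge x₀ μ' ν' q.2} =
      (partitionFunction (d := d) (L := L) u1Rep β)⁻¹ * (2⁻¹ *
        ((∫⁻ U in {U | topCharge x₀ μ' ν' (W * U) ≠ topCharge x₀ μ' ν' U},
            ENNReal.ofReal (Real.exp (-(β * max (wilsonAction u1Rep U)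
              (wilsonAction u1Rep (W * U))))) ∂(u1Haar d L)) +
          ∫⁻ U in {U | topCharge x₀ μ' ν' (W⁻¹ * U) ≠ topCharge x₀ μ' ν' U},
            ENNReal.ofReal (Real.exp (-(β * max (wilsonAction u1Rep U)
              (wilsonAction u1Rep (W⁻¹ * U))))) ∂(u1Haar d L))) := by
  haveI : IsProbabilityMeasure (wilsonMeasure (d := d) (L := L) u1Rep β) :=
    isProbabilityMeasure_wilsonMeasure u1Rep continuous_u1Rep β
  have hQ := measurable_topCharge (L := L) x₀ μ' ν'
  have hp := measurable_u1Weight (d := d) (L := L) β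
  have hA : ∀ X : GaugeConfig d L Circle,
      MeasurableSet {U | topCharge x₀ μ' ν' (X * U) ≠ topCharge x₀ μ' ν' U} :=
    fun X => measurableSet_chargeNe_mul hQ X
  have hg : Measurable fun U : GaugeConfig d L Circle => 2⁻¹ *
      ({U | topCharge x₀ μ' ν' (W * U) ≠ topCharge x₀ μ' ν' U}.indicator
          (fun U => imhAcceptE (u1Weight β) U (W * U)) U +
        {U | topCharge x₀ μ' ν' (W⁻¹ * U) ≠ topCharge x₀ μ' ν' U}.indicator
          (fun U => imhAcceptE (u1Weight β) U (W⁻¹ * U)) U) :=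
    (((measurable_imhAcceptE_mul hp W).indicator (hA W)).add
      ((measurable_imhAcceptE_mul hp W⁻¹).indicator (hA W⁻¹))).const_mul _
  rw [compProd_insertionMH_chargeNe hQ W hp,
    show wilsonMeasure u1Rep β = (partitionFunction (d := d) (L := L) u1Rep β)⁻¹ •
      (u1Haar d L).withDensity (fun U => ENNReal.ofReal (Real.exp (-β * wilsonAction u1Rep U)))
      from rfl,
    lintegral_smul_measure, lintegral_withDensity_eq_lintegral_mul _ (measurable_u1Density β) hg,
    smul_eq_mul]
  congr 1
  have hpt : ∀ U : GaugeConfig d L Circle,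
      ((fun U : GaugeConfig d L Circle => ENNReal.ofReal (Real.exp (-β * wilsonAction u1Rep U))) *
          fun U => 2⁻¹ *
            ({U | topCharge x₀ μ' ν' (W * U) ≠ topCharge x₀ μ' ν' U}.indicator
                (fun U => imhAcceptE (u1Weight β) U (W * U)) U +
              {U | topCharge x₀ μ' ν' (W⁻¹ * U) ≠ topCharge x₀ μ' ν' U}.indicator
                (fun U => imhAcceptE (u1Weight β) U (W⁻¹ * U)) U)) U =
        2⁻¹ * ({U | topCharge x₀ μ' ν' (W * U) ≠ topCharge x₀ μ' ν' U}.indicator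
            (fun U => ENNReal.ofReal (Real.exp (-(β * max (wilsonAction u1Rep U)
              (wilsonAction u1Rep (W * U)))))) U +
          {U | topCharge x₀ μ' ν' (W⁻¹ * U) ≠ topCharge x₀ μ' ν' U}.indicator
            (fun U => ENNReal.ofReal (Real.exp (-(β * max (wilsonAction u1Rep U)
              (wilsonAction u1Rep (W⁻¹ * U)))))) U) := by
    intro U
    have key : ∀ X : GaugeConfig d L Circle,
        ENNReal.ofReal (Real.exp (-β * wilsonAction u1Rep U)) *
            {U | topCharge x₀ μ' ν' (X * U) ≠ topCharge x₀ μ' ν' U}.indicator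
              (fun U => imhAcceptE (u1Weight β) U (X * U)) U =
          {U | topCharge x₀ μ' ν' (X * U) ≠ topCharge x₀ μ' ν' U}.indicator
            (fun U => ENNReal.ofReal (Real.exp (-(β * max (wilsonAction u1Rep U)
              (wilsonAction u1Rep (X * U)))))) U := by
      intro X
      by_cases hU : U ∈ {U | topCharge x₀ μ' ν' (X * U) ≠ topCharge x₀ μ' ν' U}
      · rw [Set.indicator_of_mem hU, Set.indicator_of_mem hU, u1Density_mul_imhAcceptE hβ]
      · rw [Set.indicator_of_notMem hU, Set.indicator_of_notMem hU, mul_zero]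
    simp only [Pi.mul_apply]
    rw [mul_left_comm, mul_add, key W, key W⁻¹]
  simp_rw [hpt]
  rw [lintegral_const_mul' _ _ (ENNReal.inv_ne_top.mpr two_ne_zero),
    lintegral_add_left ((measurable_expMax β W).indicator (hA W)),
    lintegral_indicator (hA W), lintegral_indicator (hA W⁻¹)]

end Wilson

end Summit.Ventures.LatticeQCDFlow.Theory2.Lattice.Flux

end
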